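import Literature.Analysis.FluidPDE.FluidComputer.TubeTable
import HarnessLib

/-!
# Kernel run of the tube checker, chunks 18 … 23 (steps 900 … 1199) (bp3 gen 13)

HONEST FRAMING: low prior, high value-of-information experiment on Tao's machine paradigm; NOT a
claim that NS blows up.

Kernel evaluations (`decide +kernel`; no `native_decide`, no extra axioms) of the tube checker
`runTube` of `TubeCheck.lean` (dyadic interval arithmetic `DI` at `P = 60`, `12` Taylor terms,
cube radius `Rt`, read-out level `CLt`) on the chunks `cT 18 … cT 23` of the schedule of
`TubeTable.lean`, each from the recorded boundary state `sT i` to `sT (i+1)` (≈ 0.6 s of kernel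
time per step).
-/

namespace Literature.Analysis.FluidPDE.FluidComputer

namespace TubeTable

open ThresholdLevelTable

set_option maxHeartbeats 10000000 in
set_option maxRecDepth 200000 in
/-- Chunk 18 of the tube run (steps 900 … 949, `h = 2^-11`). [folklore] -/
theorem run_18 : runTube 60 12 GIt CLt Rt (sT 18) (cT 18) = some (sT (18 + 1)) := by
  decide +kernel

set_option maxHeartbeats 10000000 in
set_option maxRecDepth 200000 in
/-- Chunk 19 of the tube run (steps 950 … 999, `h = 2^-11`). [folklore] -/
theorem run_19 : runTube 60 12 GIt CLt Rt (sT 19) (cT 19) = some (sT (19 + 1)) := by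
  decide +kernel

set_option maxHeartbeats 10000000 in
set_option maxRecDepth 200000 in
/-- Chunk 20 of the tube run (steps 1000 … 1049, `h = 2^-11`). [folklore] -/
theorem run_20 : runTube 60 12 GIt CLt Rt (sT 20) (cT 20) = some (sT (20 + 1)) := by
  decide +kernel

set_option maxHeartbeats 10000000 in
set_option maxRecDepth 200000 in
/-- Chunk 21 of the tube run (steps 1050 … 1099, `h = 2^-11`). [folklore] -/
theorem run_21 : runTube 60 12 GIt CLt Rt (sT 21) (cT 21) = some (sT (21 + 1)) := by
  decide +kernel

set_option maxHeartbeats 10000000 in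
set_option maxRecDepth 200000 in
/-- Chunk 22 of the tube run (steps 1100 … 1149, `h = 2^-11`). [folklore] -/
theorem run_22 : runTube 60 12 GIt CLt Rt (sT 22) (cT 22) = some (sT (22 + 1)) := by
  decide +kernel

set_option maxHeartbeats 10000000 in
set_option maxRecDepth 200000 in
/-- Chunk 23 of the tube run (steps 1150 … 1199, `h = 2^-11`). [folklore] -/
theorem run_23 : runTube 60 12 GIt CLt Rt (sT 23) (cT 23) = some (sT (23 + 1)) := by
  decide +kernel

end TubeTable

end Literature.Analysis.FluidPDE.FluidComputer
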